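import Summits.CriticalPhenomena.SAWScalingLimit.Theorems.SAWDefectDecoherenceBoundaryClosureRZigzagDiscretisationSide
import Summits.CriticalPhenomena.SAWScalingLimit.Theorems.SAWDefectDecoherenceBoundaryClosureRZigzagDiscretisationMember
import HarnessLib

/-!
# Crux `BoundaryClosureR` (stmt-CriticalPhenomena-14004), line `polygon-parity-squeeze`,
# stub `stub_innerPolygonsOfZigzag` (7b): local characterisations of the trimmed discretisation

Landing target:
`Summits/CriticalPhenomena/SAWScalingLimit/Theorems/SAWDefectDecoherenceBoundaryClosureRZigzagDiscretisationCorner.lean`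
(`--supports stmt-CriticalPhenomena-14004`; building block of the registered stub
`stub_innerPolygonsOfZigzag`, the lattice half of the inner-polygon construction (IP)).

The trimmed discretisation `Λ^P_δ = zdLam …` is, eventually and LOCALLY, an explicit exact set:

* `zdPass_of_corner` — near a corner `c` (`p ∈ ball c (3r/2)`), `p ∈ P` and the corner condition of
  the chart `κ c` pass all tests that see `p` (one mesh);
* `eventually_zdLam_iff_side` — eventually, for every `r`-far frontier point `z` with flat chart of
  form `k` and every face with `δ c_v ∈ ball z (3r/8)`:
  `v ∈ Λ^P_δ ↔ δ c_v ∈ P ∧ zdT k z ≤ zigzagForm k v`;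
* `eventually_zdLam_iff_corner` — eventually, for every corner `c` and face with `δ c_v ∈ ball c (3r/2)`:
  `v ∈ Λ^P_δ ↔ δ c_v ∈ P ∧ (corner condition of κ c)`.

(Membership in `Λ δ` is automatic by K1, `eventually_mem_of_zdPass`.)  Sources: folklore.  No
proposition is defined and no named fact is introduced.
-/

noncomputable section

open scoped ComplexConjugate Topology
open Set Metric Filter
open Literature.Probability.LatticeModels Literature.Probability.RandomPlanarGeometry
  Literature.Probability.RandomPlanarGeometry.SAW
open Summit.CriticalPhenomena.SAWScalingLimit.Theorems.PolygonParitySqueeze.InnerZigzag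
  (level_split level_add_smul halfPlane_eq_of_level_eq_zero)

namespace Summit.CriticalPhenomena.SAWScalingLimit.Theorems.PolygonParitySqueeze.ZigzagDiscretisation

/-! ### 1. One mesh: the corner condition passes all tests -/

section OneMesh

variable {D : DobrushinDomain} {S : Set ℂ} {Cor : Finset ℂ} {κ : ℂ → Fin 6 × Fin 6 × Bool} {r ρ r₁ δ : ℝ}
  {x₁ x₀ : ℂ} {m m₀ : ℤ}

/-- **Near a corner, `p ∈ P` and the corner condition pass all tests that see `p`.** [folklore] -/
theorem zdPass_of_corner (hr : 0 < r) (hδ : 0 < δ)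
    (hD1 : D.carrier ∩ ball x₁ ρ = {z : ℂ | x₁.im < z.im} ∩ ball x₁ ρ)
    (hD0 : D.carrier ∩ ball x₀ r₁ = {z : ℂ | x₀.im < z.im} ∩ ball x₀ r₁)
    (hF : ∀ w ∈ frontier S, w ∉ ball x₁ (15 * ρ / 16) → w ∉ ball x₀ (15 * r₁ / 16) → w ∈ D.carrier)
    (hsep01 : ρ + r₁ ≤ dist x₀ x₁) (hρ : 0 ≤ ρ) (hr₁ : 0 ≤ r₁)
    (hCor : ∀ c ∈ Cor, c ∈ frontier S)
    (hsep : ∀ c ∈ Cor, ∀ c' ∈ Cor, c ≠ c' → 4 * r ≤ dist c c')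
    (hflat : ∀ z ∈ frontier S, (∀ c ∈ Cor, r ≤ dist z c) → ∃ k : Fin 6, S ∩ ball z (r / 2) = halfPlane k z ∩ ball z (r / 2))
    (Hκ : ∀ c ∈ Cor, ((κ c).2.2 = true ∧ S ∩ ball c (2 * r) = halfPlane (κ c).1 c ∩ halfPlane (κ c).2.1 c ∩ ball c (2 * r)) ∨
      ((κ c).2.2 = false ∧ S ∩ ball c (2 * r) = (halfPlane (κ c).1 c ∪ halfPlane (κ c).2.1 c) ∩ ball c (2 * r)))
    (hmargin : δ * (Real.sqrt 3 / 6 + Real.sqrt 3 / 2 * ((|m - zdThr 0 x₁ δ| + |m₀ - zdThr 0 x₀ δ| + 2 : ℤ) : ℝ)) ≤ r / 16)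
    {c : ℂ} (hc : c ∈ Cor) {v : HexVertex} (hpS : (δ : ℂ) * hexCenter v ∈ S)
    (hcond : ((κ c).2.2 = true → zdT x₁ x₀ ρ r₁ m m₀ δ (κ c).1 c ≤ zigzagForm (κ c).1 v ∧
        zdT x₁ x₀ ρ r₁ m m₀ δ (κ c).2.1 c ≤ zigzagForm (κ c).2.1 v) ∧
      ((κ c).2.2 = false → zdT x₁ x₀ ρ r₁ m m₀ δ (κ c).1 c ≤ zigzagForm (κ c).1 v ∨
        zdT x₁ x₀ ρ r₁ m m₀ δ (κ c).2.1 c ≤ zigzagForm (κ c).2.1 v))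
    (hpc : (δ : ℂ) * hexCenter v ∈ ball c (3 * r / 2)) :
    zdPass S Cor κ r (zdT x₁ x₀ ρ r₁ m m₀ δ) δ v = true := by
  have hs := sqrt_three_div_two_gt
  have h3p : 0 < Real.sqrt 3 := Real.sqrt_pos.2 (by norm_num)
  set U : ℤ := |m - zdThr 0 x₁ δ| + |m₀ - zdThr 0 x₀ δ| + 2 with hU
  have hU0 : (0 : ℝ) ≤ U := by
    have h1 := abs_nonneg (m - zdThr 0 x₁ δ); have h2 := abs_nonneg (m₀ - zdThr 0 x₀ δ)
    have : (0 : ℤ) ≤ U := by rw [hU]; linarith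
    exact_mod_cast this
  have hmU : δ * (Real.sqrt 3 / 2 * U) ≤ r / 16 := by nlinarith
  set p : ℂ := (δ : ℂ) * hexCenter v with hp
  have hpc' : dist p c < 3 * r / 2 := mem_ball.1 hpc
  have hcF := hCor c hc
  have hno := corner_not_opposite hr hCor hsep hflat Hκ hc
  have hno' : (innerNormal (κ c).2.1 * conj (innerNormal (κ c).1)).re ≠ -1 := by rwa [inner_innerNormal_comm]
  rw [zdPass_iff]
  refine ⟨hpS, ?_, ?_⟩
  · intro z' hz'F hfar hpz8 j hj
    have hz'c' : dist z' c < 2 * r := by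
      calc dist z' c ≤ dist z' p + dist p c := dist_triangle _ _ _
        _ < r / 8 + 3 * r / 2 := by rw [dist_comm]; linarith
        _ < 2 * r := by linarith
    have hz'B : z' ∈ ball c (2 * r) := mem_ball.2 hz'c'
    have hz'c : z' ≠ c := by
      intro h; have := hfar c hc; rw [h, dist_self] at this; linarith
    have hzcr : r ≤ ‖z' - c‖ := by rw [← dist_eq_norm]; exact hfar c hc
    -- the test of `z'` is the test of the ray's form at `c`
    have transfer : ∀ {k₁ : Fin 6}, j = k₁ → segment ℝ c z' ⊆ frontier S →
        ((z' - c) * conj (innerNormal k₁)).re = 0 → zdT x₁ x₀ ρ r₁ m m₀ δ k₁ c ≤ zigzagForm k₁ v →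
        zdT x₁ x₀ ρ r₁ m m₀ δ j z' ≤ zigzagForm j v := by
      rintro k₁ rfl hseg h0 hT
      rwa [zdT_eq_of_segment hD1 hD0 hF hsep01 hρ hr₁ m m₀ δ j hseg h0]
    have reflex_other : ∀ {k₂ : Fin 6}, ((z' - c) * conj (innerNormal k₂)).re = -(Real.sqrt 3 / 2 * ‖z' - c‖) →
        ¬ zdT x₁ x₀ ρ r₁ m m₀ δ k₂ c ≤ zigzagForm k₂ v := by
      intro k₂ hlev
      apply not_zdT_le_of_level_le x₁ x₀ ρ r₁ m m₀ hδ k₂ c v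
      rw [← hp, level_split (innerNormal k₂) p c z', hlev]
      have h1 := abs_level_le_dist k₂ z' p
      have h2 := le_abs_self ((p - z') * conj (innerNormal k₂)).re
      have h4 : 17 / 20 * r ≤ Real.sqrt 3 / 2 * ‖z' - c‖ := by nlinarith [norm_nonneg (z' - c)]
      have hmU' : δ * (Real.sqrt 3 / 2 * ((|m - zdThr 0 x₁ δ| + |m₀ - zdThr 0 x₀ δ| + 2 : ℤ) : ℝ)) ≤ r / 16 := hmU
      have hpz : dist p z' < r / 8 := hpz8
      push_cast at hmU' ⊢
      linarith
    rcases Hκ c hc with ⟨hb, hch⟩ | ⟨hb, hch⟩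
    · obtain ⟨hT1, hT2⟩ := hcond.1 hb
      rcases frontier_of_inter_chart hch hz'F hz'B with ⟨h0, -⟩ | ⟨h0, -⟩
      · obtain ⟨hk1, hseg, -⟩ := ray_inter_facts hr hch hno hcF hz'F hz'B hz'c hj h0
        exact transfer hk1 hseg h0 hT1
      · rw [inter_comm (halfPlane (κ c).1 c)] at hch
        obtain ⟨hk1, hseg, -⟩ := ray_inter_facts hr hch hno' hcF hz'F hz'B hz'c hj h0
        exact transfer hk1 hseg h0 hT2
    · have hT := hcond.2 hb
      rcases frontier_of_union_chart hch hz'F hz'B with ⟨h0, -⟩ | ⟨h0, -⟩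
      · obtain ⟨hk1, hseg, hother⟩ := ray_union_facts hr hch hno hz'F hz'B hz'c hj h0
        rcases hT with hT | hT
        · exact transfer hk1 hseg h0 hT
        · rcases hother with heq | hlev
          · rw [heq] at hT; exact transfer hk1 hseg h0 hT
          · exact absurd hT (reflex_other hlev)
      · rw [union_comm] at hch
        obtain ⟨hk1, hseg, hother⟩ := ray_union_facts hr hch hno' hz'F hz'B hz'c hj h0
        rcases hT with hT | hT
        · rcases hother with heq | hlev
          · rw [heq] at hT; exact transfer hk1 hseg h0 hT
          · exact absurd hT (reflex_other hlev)
        · exact transfer hk1 hseg h0 hT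
  · intro c' hc' hpc2
    have hcc : c' = c := by
      by_contra hne
      have h1 := hsep c hc c' hc' (Ne.symm hne)
      have h2 : dist c c' ≤ dist c p + dist p c' := dist_triangle _ _ _
      rw [dist_comm c p] at h2
      linarith
    subst hcc
    exact hcond

end OneMesh

/-! ### 2. Eventually: the local characterisations -/

/-- The float margin `δ(√3/6 + (√3/2)u) ≤ r/16` once `δ ≤ r/32`, `δ·u ≤ r/32`. [folklore] -/
theorem margin_le_of_small {δ r : ℝ} {U : ℤ} (hδ : 0 < δ) (hδr : δ ≤ r / 32) (hU : δ * (U : ℝ) ≤ r / 32)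
    (_hU0 : (0 : ℝ) ≤ U) : δ * (Real.sqrt 3 / 6 + Real.sqrt 3 / 2 * U) ≤ r / 16 := by
  have h32 : Real.sqrt 3 < 2 := by
    rw [show (2 : ℝ) = Real.sqrt 4 by rw [show (4 : ℝ) = 2 ^ 2 by norm_num, Real.sqrt_sq (by norm_num)]]
    exact Real.sqrt_lt_sqrt (by norm_num) (by norm_num)
  have h3p : 0 < Real.sqrt 3 := Real.sqrt_pos.2 (by norm_num)
  nlinarith

section Eventually

variable {D : DobrushinDomain} {S : Set ℂ} {Cor : Finset ℂ} {κ : ℂ → Fin 6 × Fin 6 × Bool}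
  {r ρ r₁ r₀ : ℝ} {Λ : ℝ → Finset HexVertex} {m m₀ : ℝ → ℤ} {a b : ℝ → Sym2 HexVertex}

/-- **Local characterisation near a flat chart, eventually**: for `r`-far frontier points `z` with
chart of form `k` and faces with `δ c_v ∈ ball z (3r/8)`,
`v ∈ Λ^P_δ ↔ δ c_v ∈ P ∧ zdT k z ≤ zigzagForm k v`. [folklore] -/
theorem eventually_zdLam_iff_side
    (hA : AdmissibleFamily D ρ Λ m b) (hP : PinnedFlatRoot D Λ b (D.pt 0) a r₀ m₀)
    (hSo : IsOpen S) (hSD : S ⊆ D.carrier) (hr : 0 < r) (hrρ : r ≤ ρ / 16) (hrr₁ : r ≤ r₁ / 16) (hr₁r₀ : r₁ ≤ r₀)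
    (hD0 : D.carrier ∩ ball (D.pt 0) r₁ = {z : ℂ | (D.pt 0).im < z.im} ∩ ball (D.pt 0) r₁)
    (hF : ∀ w ∈ frontier S, w ∉ ball (D.pt 1) (15 * ρ / 16) → w ∉ ball (D.pt 0) (15 * r₁ / 16) → w ∈ D.carrier)
    (hdist : ρ + r₁ ≤ dist (D.pt 0) (D.pt 1))
    (hCor : ∀ c ∈ Cor, c ∈ frontier S)
    (hsep : ∀ c ∈ Cor, ∀ c' ∈ Cor, c ≠ c' → 4 * r ≤ dist c c')
    (hflat : ∀ z ∈ frontier S, (∀ c ∈ Cor, r ≤ dist z c) → ∃ k : Fin 6, S ∩ ball z (r / 2) = halfPlane k z ∩ ball z (r / 2))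
    (Hκ : ∀ c ∈ Cor, ((κ c).2.2 = true ∧ S ∩ ball c (2 * r) = halfPlane (κ c).1 c ∩ halfPlane (κ c).2.1 c ∩ ball c (2 * r)) ∨
      ((κ c).2.2 = false ∧ S ∩ ball c (2 * r) = (halfPlane (κ c).1 c ∪ halfPlane (κ c).2.1 c) ∩ ball c (2 * r))) :
    ∀ᶠ δ : ℝ in 𝓝[>] 0, ∀ z ∈ frontier S, (∀ c ∈ Cor, r ≤ dist z c) → ∀ k : Fin 6,
      S ∩ ball z (r / 2) = halfPlane k z ∩ ball z (r / 2) → ∀ v : HexVertex,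
      (δ : ℂ) * hexCenter v ∈ ball z (3 * r / 8) →
      (v ∈ zdLam S Cor κ r (D.pt 1) (D.pt 0) ρ r₁ Λ m m₀ δ ↔
        ((δ : ℂ) * hexCenter v ∈ S ∧ zdT (D.pt 1) (D.pt 0) ρ r₁ (m δ) (m₀ δ) δ k z ≤ zigzagForm k v)) := by
  have hK1 := eventually_mem_of_zdPass hA hP hSo hSD hr hrρ hrr₁ hr₁r₀ hD0 hF hdist hflat Hκ hCor
  have hfloat := eventually_delta_mul_float_le hA hP (show (0 : ℝ) < r / 32 by positivity)
  obtain ⟨hρ, hD1, -, -, -⟩ := hA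
  have hr₁ : 0 < r₁ := by linarith
  have hδ1 : ∀ᶠ δ : ℝ in 𝓝[>] 0, δ ∈ Ioo (0 : ℝ) (r / 32) := Ioo_mem_nhdsGT (by positivity)
  filter_upwards [hK1, hfloat, hδ1] with δ hK1δ hflδ hδδ z hzF hfar k hk v hpz
  have hδ : 0 < δ := hδδ.1
  have hU0 : (0 : ℝ) ≤ (|m δ - zdThr 0 (D.pt 1) δ| + |m₀ δ - zdThr 0 (D.pt 0) δ| + 2 : ℤ) := by
    have h1 := abs_nonneg (m δ - zdThr 0 (D.pt 1) δ); have h2 := abs_nonneg (m₀ δ - zdThr 0 (D.pt 0) δ)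
    have : (0 : ℤ) ≤ |m δ - zdThr 0 (D.pt 1) δ| + |m₀ δ - zdThr 0 (D.pt 0) δ| + 2 := by linarith
    exact_mod_cast this
  have hmargin := margin_le_of_small hδ hδδ.2.le hflδ hU0
  constructor
  · intro hv
    rw [mem_zdLam_iff] at hv
    have hpS : (δ : ℂ) * hexCenter v ∈ S := ((zdPass_iff _ _ _ _ _ _ _).1 hv.2).1
    exact ⟨hpS, test_of_zdPass_side hr hδ hD1 hD0 hF hdist hρ.le hr₁.le hCor hsep hflat Hκ hmargin hzF hfar hk hv.2 hpz⟩
  · rintro ⟨hpS, hT⟩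
    have hpass := zdPass_of_side hr hδ hD1 hD0 hF hdist hρ.le hr₁.le hCor hsep hflat Hκ hmargin hzF hfar hk hpS hT hpz
    rw [mem_zdLam_iff]
    exact ⟨hK1δ v hpass, hpass⟩

/-- **Local characterisation near a corner, eventually**: for corners `c` and faces with
`δ c_v ∈ ball c (3r/2)`, `v ∈ Λ^P_δ ↔ δ c_v ∈ P ∧ (corner condition of κ c)`. [folklore] -/
theorem eventually_zdLam_iff_corner
    (hA : AdmissibleFamily D ρ Λ m b) (hP : PinnedFlatRoot D Λ b (D.pt 0) a r₀ m₀)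
    (hSo : IsOpen S) (hSD : S ⊆ D.carrier) (hr : 0 < r) (hrρ : r ≤ ρ / 16) (hrr₁ : r ≤ r₁ / 16) (hr₁r₀ : r₁ ≤ r₀)
    (hD0 : D.carrier ∩ ball (D.pt 0) r₁ = {z : ℂ | (D.pt 0).im < z.im} ∩ ball (D.pt 0) r₁)
    (hF : ∀ w ∈ frontier S, w ∉ ball (D.pt 1) (15 * ρ / 16) → w ∉ ball (D.pt 0) (15 * r₁ / 16) → w ∈ D.carrier)
    (hdist : ρ + r₁ ≤ dist (D.pt 0) (D.pt 1))
    (hCor : ∀ c ∈ Cor, c ∈ frontier S)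
    (hsep : ∀ c ∈ Cor, ∀ c' ∈ Cor, c ≠ c' → 4 * r ≤ dist c c')
    (hflat : ∀ z ∈ frontier S, (∀ c ∈ Cor, r ≤ dist z c) → ∃ k : Fin 6, S ∩ ball z (r / 2) = halfPlane k z ∩ ball z (r / 2))
    (Hκ : ∀ c ∈ Cor, ((κ c).2.2 = true ∧ S ∩ ball c (2 * r) = halfPlane (κ c).1 c ∩ halfPlane (κ c).2.1 c ∩ ball c (2 * r)) ∨
      ((κ c).2.2 = false ∧ S ∩ ball c (2 * r) = (halfPlane (κ c).1 c ∪ halfPlane (κ c).2.1 c) ∩ ball c (2 * r))) :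
    ∀ᶠ δ : ℝ in 𝓝[>] 0, ∀ c ∈ Cor, ∀ v : HexVertex, (δ : ℂ) * hexCenter v ∈ ball c (3 * r / 2) →
      (v ∈ zdLam S Cor κ r (D.pt 1) (D.pt 0) ρ r₁ Λ m m₀ δ ↔
        ((δ : ℂ) * hexCenter v ∈ S ∧
          (((κ c).2.2 = true → zdT (D.pt 1) (D.pt 0) ρ r₁ (m δ) (m₀ δ) δ (κ c).1 c ≤ zigzagForm (κ c).1 v ∧
              zdT (D.pt 1) (D.pt 0) ρ r₁ (m δ) (m₀ δ) δ (κ c).2.1 c ≤ zigzagForm (κ c).2.1 v) ∧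
            ((κ c).2.2 = false → zdT (D.pt 1) (D.pt 0) ρ r₁ (m δ) (m₀ δ) δ (κ c).1 c ≤ zigzagForm (κ c).1 v ∨
              zdT (D.pt 1) (D.pt 0) ρ r₁ (m δ) (m₀ δ) δ (κ c).2.1 c ≤ zigzagForm (κ c).2.1 v)))) := by
  have hK1 := eventually_mem_of_zdPass hA hP hSo hSD hr hrρ hrr₁ hr₁r₀ hD0 hF hdist hflat Hκ hCor
  have hfloat := eventually_delta_mul_float_le hA hP (show (0 : ℝ) < r / 32 by positivity)
  obtain ⟨hρ, hD1, -, -, -⟩ := hA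
  have hr₁ : 0 < r₁ := by linarith
  have hδ1 : ∀ᶠ δ : ℝ in 𝓝[>] 0, δ ∈ Ioo (0 : ℝ) (r / 32) := Ioo_mem_nhdsGT (by positivity)
  filter_upwards [hK1, hfloat, hδ1] with δ hK1δ hflδ hδδ c hc v hpc
  have hδ : 0 < δ := hδδ.1
  have hU0 : (0 : ℝ) ≤ (|m δ - zdThr 0 (D.pt 1) δ| + |m₀ δ - zdThr 0 (D.pt 0) δ| + 2 : ℤ) := by
    have h1 := abs_nonneg (m δ - zdThr 0 (D.pt 1) δ); have h2 := abs_nonneg (m₀ δ - zdThr 0 (D.pt 0) δ)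
    have : (0 : ℤ) ≤ |m δ - zdThr 0 (D.pt 1) δ| + |m₀ δ - zdThr 0 (D.pt 0) δ| + 2 := by linarith
    exact_mod_cast this
  have hmargin := margin_le_of_small hδ hδδ.2.le hflδ hU0
  constructor
  · intro hv
    rw [mem_zdLam_iff, zdPass_iff] at hv
    obtain ⟨-, hpS, -, hcorner⟩ := hv
    exact ⟨hpS, hcorner c hc (mem_ball.1 hpc)⟩
  · rintro ⟨hpS, hcond⟩
    have hpass := zdPass_of_corner hr hδ hD1 hD0 hF hdist hρ.le hr₁.le hCor hsep hflat Hκ hmargin hc hpS hcond hpc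
    rw [mem_zdLam_iff]
    exact ⟨hK1δ v hpass, hpass⟩

end Eventually

/-- **The float margin is below `r/16`** (registered form, sub-goal of `stub_innerPolygonsOfZigzag`). [folklore] -/
theorem zd_margin_le_of_small : ∀ (δ r : ℝ) (U : ℤ), 0 < δ → δ ≤ r / 32 → δ * (U : ℝ) ≤ r / 32 → (0 : ℝ) ≤ U → δ * (Real.sqrt 3 / 6 + Real.sqrt 3 / 2 * U) ≤ r / 16 :=
  fun _ _ _ hδ hδr hU hU0 => margin_le_of_small hδ hδr hU hU0

end Summit.CriticalPhenomena.SAWScalingLimit.Theorems.PolygonParitySqueeze.ZigzagDiscretisation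

end
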